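import Summits.ResolutionOfSingularities.ResolutionOfSingularities.Theorems.FrobeniusLadderFRationalResolutionBlowupComaximalCentres
import Literature.AlgebraicGeometry.Resolution.AdicNoetherian
import Mathlib.RingTheory.AdicCompletion.AsTensorProduct
import Mathlib.RingTheory.AdicCompletion.LocalRing
import Mathlib.RingTheory.Flat.FaithfullyFlat.Algebra
import Mathlib.RingTheory.Localization.AtPrime.Basic
import Mathlib.AlgebraicGeometry.Morphisms.Flat
import HarnessLib

/-!
# Crux `FrobeniusLadder.FRationalResolution` (stmt-ResolutionOfSingularities-15317), line `redirect`,
# stub `stub_diagonalizableQuotientResolution` — regularity of `Bl_I(Spec B)` for a `𝔮`-coprimary centre `I` may be checked on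
# ONE FLAT CHART AT THE POINT `𝔮`: the local ring `B_𝔮`, its adic completion `B̂_𝔮`, or any flat `B`-algebra with a prime over `𝔮`

The COMPLETION STEP of the Galois route (MEMO-15317-leafhand2-g14 §3, -g15 §3 (S2)): the one-point obligation
`…GaloisBaseChangeRegular.hloc_of_decomposition_stable_piece'` asks for the regularity of `Bl_I(Spec B'_g)` for a `𝔔'`-primary
piece `I`; the analysis of the twisted case lives in the complete local ring `Ê = (B'_{𝔔'})^` (a `K`-form of the split toric germ).
This file supplies the descent: for `B` Noetherian, `𝔮` maximal, `𝔮ⁿ ⊆ I ⊆ 𝔮` and `Spec B ∖ {𝔮}` regular,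

* `isRegular_affineBlowup_of_flat_chart` — if `C` is a FLAT `B`-algebra with a prime `𝔚` over `𝔮` and `Bl_{IC}(Spec C)` is regular,
  then `Bl_I(Spec B)` is regular (flat cover of `Spec B` by `Spec C` and the basic opens `D(h)`, `h ∈ I`, on which the blow-up is an
  isomorphism onto a regular scheme; blow-ups commute with flat base change, GW 13.91 (2); regularity descends along flat local maps,
  Matsumura 23.7 (i) — tree `IsBlowup.isRegular_of_flat_cover`);
* `isRegular_affineBlowup_of_faithfullyFlat` — the same for a FAITHFULLY flat `C` and any `I` (no hypothesis off `𝔮`);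
* `isRegular_affineBlowup_of_atPrime` — `C = B_𝔮`;
* `isRegular_affineBlowup_of_adicCompletion` — `R` Noetherian local: `Bl_{I R̂}(Spec R̂)` regular ⇒ `Bl_I(Spec R)` regular
  (`R → R̂` faithfully flat: Mathlib `AdicCompletion.flat_of_isNoetherian` + `Module.FaithfullyFlat.of_flat_of_isLocalHom`);
* `isRegular_affineBlowup_of_adicCompletion_atPrime` — `C = (B_𝔮)^`: THE COMPLETION STEP for `hreg`.

Honest label: generic scheme plumbing toward ONE leaf stub (no stub, crux or summit closed). No definitions, no named facts, no
sorry. [cite: GortzWedhorn2020, Prop. 13.91 (2)] [cite: Matsumura1987, Thm. 23.7 (i); Thm. 8.14] [cite: StacksProject, Tag 02NS; Tag 00MC]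
-/

noncomputable section

-- single-problem summit: the doubled namespace component is forced
set_option linter.dupNamespace false

open CategoryTheory CategoryTheory.Limits AlgebraicGeometry
open Literature.AlgebraicGeometry.Resolution
open Summit.ResolutionOfSingularities.ResolutionOfSingularities.Theorems.FRationalResolution

namespace Summit.ResolutionOfSingularities.ResolutionOfSingularities.Theorems.FRationalResolution.BlowupRegularFlatChart

/-- Every blowing up of `Spec C` along the pull-back of `Ĩ` under `Spec φ` is regular as soon as `Bl_{Iφ}(Spec C)` is (uniqueness
of blow-ups). [cite: GortzWedhorn2020, Prop. 13.91] -/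
theorem isRegular_of_isBlowup_comap_specMap {B C : Type} [CommRing B] [CommRing C] (φ : B →+* C) (I : Ideal B)
    (h : Scheme.IsRegular (affineBlowup (I.map φ))) {P : Scheme.{0}} (q : P ⟶ Spec (.of C))
    (hq : IsBlowup q ((affineBlowup.idealSheaf I).comap (Spec.map (CommRingCat.ofHom φ)))) :
    Scheme.IsRegular P := by
  rw [BlowupFlatCriteria.idealSheaf_comap_specMap] at hq
  obtain ⟨e, -, -⟩ := (affineBlowup.isBlowup (I.map φ)).unique hq
  exact Scheme.IsRegular.of_iso e.hom h

/-- `Spec` of a flat algebra map is flat. [folklore] -/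
theorem flat_specMap_algebraMap (B C : Type) [CommRing B] [CommRing C] [Algebra B C] [Module.Flat B C] :
    Flat (Spec.map (CommRingCat.ofHom (algebraMap B C))) := by
  rw [HasRingHomProperty.Spec_iff (P := @Flat), CommRingCat.hom_ofHom]
  exact RingHom.flat_algebraMap_iff.mpr inferInstance

/-- **Regularity of `Bl_I(Spec B)` descends along a faithfully flat base change** (`B` Noetherian, any `I`): if
`Bl_{IC}(Spec C)` is regular for a faithfully flat `B`-algebra `C`, then `Bl_I(Spec B)` is regular.
[cite: GortzWedhorn2020, Prop. 13.91 (2)] [cite: Matsumura1987, Thm. 23.7 (i)] -/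
theorem isRegular_affineBlowup_of_faithfullyFlat {B C : Type} [CommRing B] [CommRing C] [IsNoetherianRing B]
    [Algebra B C] [Module.FaithfullyFlat B C] (I : Ideal B)
    (h : Scheme.IsRegular (affineBlowup (I.map (algebraMap B C)))) :
    Scheme.IsRegular (affineBlowup I) := by
  haveI : IsLocallyNoetherian (affineBlowup I) := LocallyOfFiniteType.isLocallyNoetherian (affineBlowup.π I)
  haveI := flat_specMap_algebraMap B C
  refine (affineBlowup.isBlowup I).isRegular_of_flat_cover
    (e := fun _ : Unit => Spec.map (CommRingCat.ofHom (algebraMap B C))) ?_ ?_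
  · intro x
    obtain ⟨y, hy⟩ := PrimeSpectrum.comap_surjective_of_faithfullyFlat (A := B) (B := C) x
    exact ⟨(), y, hy⟩
  · intro _ P q hq
    exact isRegular_of_isBlowup_comap_specMap (algebraMap B C) I h q hq

/-- **Regularity of `Bl_I(Spec B)` for a `𝔮`-coprimary `I` is detected on ONE flat chart at `𝔮`.** Let `B` be Noetherian,
`𝔮` maximal, `𝔮ⁿ ⊆ I ⊆ 𝔮`, `Spec B` regular at every prime `≠ 𝔮`, and `C` a flat `B`-algebra with a prime `𝔚` over `𝔮`.
If `Bl_{IC}(Spec C)` is regular then `Bl_I(Spec B)` is regular. Proof: `Spec C → Spec B` together with the basic opens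
`D(h) ⊆ Spec B`, `h ∈ I`, is a flat covering family (a prime `x ≠ 𝔮` does not contain `𝔮ⁿ ⊆ I`); on `D(h)` the blow-up is an
isomorphism onto the regular `Spec B_h` (`…BlowupComaximalCentres.isRegular_affineBlowup_map_of_mem`); conclude by
`IsBlowup.isRegular_of_flat_cover`. [cite: GortzWedhorn2020, Prop. 13.91 (2)] [cite: Matsumura1987, Thm. 23.7 (i)]
[cite: StacksProject, Tag 02NS] -/
theorem isRegular_affineBlowup_of_flat_chart {B C : Type} [CommRing B] [CommRing C] [IsNoetherianRing B]
    [Algebra B C] [Module.Flat B C] (𝔮 : Ideal B) [h𝔮 : 𝔮.IsMaximal] (I : Ideal B) {n : ℕ} (hI : 𝔮 ^ n ≤ I)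
    (hI𝔮 : I ≤ 𝔮) (hoff : ∀ x : Spec (.of B), x.asIdeal ≠ 𝔮 → x ∈ Scheme.regularLocus (Spec (.of B)))
    (𝔚 : Ideal C) [h𝔚 : 𝔚.IsPrime] (h𝔚𝔮 : 𝔚.comap (algebraMap B C) = 𝔮)
    (h : Scheme.IsRegular (affineBlowup (I.map (algebraMap B C)))) :
    Scheme.IsRegular (affineBlowup I) := by
  classical
  haveI : IsLocallyNoetherian (affineBlowup I) := LocallyOfFiniteType.isLocallyNoetherian (affineBlowup.π I)
  -- regularity of `Spec B` off `V(I)`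
  have hoff' : ∀ x : Spec (.of B), ¬ I ≤ x.asIdeal → x ∈ Scheme.regularLocus (Spec (.of B)) := by
    intro x hx
    refine hoff x fun hx𝔮 => hx ?_
    rw [hx𝔮]
    exact hI𝔮
  -- the covering family: `Spec C` (index `none`) and the `D(h)`, `h ∈ I` (index `some h`)
  let F : Option I → Over (Spec (.of B)) := fun k =>
    k.elim (Over.mk (Spec.map (CommRingCat.ofHom (algebraMap B C))))
      (fun h => Over.mk (Spec.map (CommRingCat.ofHom (algebraMap B (Localization.Away (h : B))))))
  haveI hflat : ∀ k, Flat ((F k).hom) := by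
    intro k
    cases k with
    | none =>
      change Flat (Spec.map (CommRingCat.ofHom (algebraMap B C)))
      exact flat_specMap_algebraMap B C
    | some h =>
      change Flat (Spec.map (CommRingCat.ofHom (algebraMap B (Localization.Away (h : B)))))
      haveI : IsOpenImmersion (Spec.map (CommRingCat.ofHom (algebraMap B (Localization.Away (h : B))))) :=
        IsOpenImmersion.of_isLocalization (h : B)
      infer_instance
  refine (affineBlowup.isBlowup I).isRegular_of_flat_cover (V := fun k => (F k).left) (fun k => (F k).hom) ?_ ?_
  · -- jointly surjective
    intro x
    by_cases hx : x.asIdeal = 𝔮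
    · -- the point `𝔚` of `Spec C` lies over `𝔮 = x`
      refine ⟨none, (⟨𝔚, h𝔚⟩ : PrimeSpectrum C), ?_⟩
      change PrimeSpectrum.comap (algebraMap B C) ⟨𝔚, h𝔚⟩ = x
      ext1
      change 𝔚.comap (algebraMap B C) = x.asIdeal
      rw [h𝔚𝔮, hx]
    · -- `x ≠ 𝔮`: some `h ∈ 𝔮ⁿ ⊆ I` avoids `x`
      have hnle : ¬ I ≤ x.asIdeal := by
        intro hle
        exact hx ((h𝔮.eq_of_le x.2.ne_top (x.2.le_of_pow_le (hI.trans hle))).symm)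
      obtain ⟨g, hgI, hgx⟩ := SetLike.not_le_iff_exists.mp hnle
      have hmem : x ∈ Set.range (PrimeSpectrum.comap (algebraMap B (Localization.Away g))) := by
        rw [PrimeSpectrum.localization_away_comap_range (Localization.Away g) g]
        exact (PrimeSpectrum.mem_basicOpen _ _).mpr hgx
      obtain ⟨y, hy⟩ := hmem
      exact ⟨some ⟨g, hgI⟩, y, hy⟩
  · -- every member of the family has regular blow-ups along the pulled-back centre
    intro k P q hq
    cases k with
    | none =>
      exact isRegular_of_isBlowup_comap_specMap (algebraMap B C) I h q hq
    | some g =>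
      exact isRegular_of_isBlowup_comap_specMap (algebraMap B (Localization.Away (g : B))) I
        (BlowupComaximalCentres.isRegular_affineBlowup_map_of_mem I hoff' g.2) q hq

/-- **Case `C = B_𝔮`: regularity of `Bl_I(Spec B)` is detected on the local ring at `𝔮`** (`B` Noetherian, `𝔮` maximal,
`𝔮ⁿ ⊆ I ⊆ 𝔮`, `Spec B ∖ {𝔮}` regular). [cite: GortzWedhorn2020, Prop. 13.91 (2)] [cite: Matsumura1987, Thm. 23.7 (i)] -/
theorem isRegular_affineBlowup_of_atPrime {B : Type} [CommRing B] [IsNoetherianRing B] (𝔮 : Ideal B) [h𝔮 : 𝔮.IsMaximal]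
    (I : Ideal B) {n : ℕ} (hI : 𝔮 ^ n ≤ I) (hI𝔮 : I ≤ 𝔮)
    (hoff : ∀ x : Spec (.of B), x.asIdeal ≠ 𝔮 → x ∈ Scheme.regularLocus (Spec (.of B)))
    (h : Scheme.IsRegular (affineBlowup (I.map (algebraMap B (Localization.AtPrime 𝔮))))) :
    Scheme.IsRegular (affineBlowup I) := by
  haveI : Module.Flat B (Localization.AtPrime 𝔮) := IsLocalization.flat _ 𝔮.primeCompl
  exact isRegular_affineBlowup_of_flat_chart 𝔮 I hI hI𝔮 hoff (IsLocalRing.maximalIdeal (Localization.AtPrime 𝔮))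
    (Localization.AtPrime.under_maximalIdeal (I := 𝔮)) h

/-- **Regularity of `Bl_I(Spec R)` descends from the adic completion** (`R` Noetherian local, `R̂ = AdicCompletion 𝔪 R`, any `I`):
`R → R̂` is flat (Mathlib `AdicCompletion.flat_of_isNoetherian`) and local, hence faithfully flat.
[cite: Matsumura1987, Thm. 8.14; Thm. 23.7 (i)] [cite: GortzWedhorn2020, Prop. 13.91 (2)] -/
theorem isRegular_affineBlowup_of_adicCompletion {R : Type} [CommRing R] [IsNoetherianRing R] [IsLocalRing R] (I : Ideal R)
    (h : Scheme.IsRegular (affineBlowup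
      (I.map (algebraMap R (AdicCompletion (IsLocalRing.maximalIdeal R) R))))) :
    Scheme.IsRegular (affineBlowup I) := by
  haveI : Module.FaithfullyFlat R (AdicCompletion (IsLocalRing.maximalIdeal R) R) :=
    Module.FaithfullyFlat.of_flat_of_isLocalHom
  exact isRegular_affineBlowup_of_faithfullyFlat I h

/-- **THE COMPLETION STEP for `hreg`.** `B` Noetherian, `𝔮` maximal, `𝔮ⁿ ⊆ I ⊆ 𝔮`, `Spec B ∖ {𝔮}` regular, `Ê := (B_𝔮)^` the adic
completion of the local ring at `𝔮`: if `Bl_{IÊ}(Spec Ê)` is regular then `Bl_I(Spec B)` is regular.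
[cite: Matsumura1987, Thm. 8.14; Thm. 23.7 (i)] [cite: GortzWedhorn2020, Prop. 13.91 (2)] [cite: StacksProject, Tag 02NS] -/
theorem isRegular_affineBlowup_of_adicCompletion_atPrime {B : Type} [CommRing B] [IsNoetherianRing B] (𝔮 : Ideal B)
    [h𝔮 : 𝔮.IsMaximal] (I : Ideal B) {n : ℕ} (hI : 𝔮 ^ n ≤ I) (hI𝔮 : I ≤ 𝔮)
    (hoff : ∀ x : Spec (.of B), x.asIdeal ≠ 𝔮 → x ∈ Scheme.regularLocus (Spec (.of B)))
    (h : Scheme.IsRegular (affineBlowup ((I.map (algebraMap B (Localization.AtPrime 𝔮))).map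
      (algebraMap (Localization.AtPrime 𝔮)
        (AdicCompletion (IsLocalRing.maximalIdeal (Localization.AtPrime 𝔮)) (Localization.AtPrime 𝔮)))))) :
    Scheme.IsRegular (affineBlowup I) := by
  haveI : IsNoetherianRing (Localization.AtPrime 𝔮) :=
    IsLocalization.isNoetherianRing 𝔮.primeCompl (Localization.AtPrime 𝔮) inferInstance
  exact isRegular_affineBlowup_of_atPrime 𝔮 I hI hI𝔮 hoff (isRegular_affineBlowup_of_adicCompletion _ h)

end Summit.ResolutionOfSingularities.ResolutionOfSingularities.Theorems.FRationalResolution.BlowupRegularFlatChart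

end
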